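import Summits.Langlands.Langlands.Theses.NonParallelVoid
import Summits.Langlands.Langlands.Theorems.NonParallelVoidVoidToLanglandsStubAvatarConjugacy
import Literature.FieldTheory.AlgClosed.PadicAlgClEquivComplex
import HarnessLib

/-!
# Line `satake-sector-cut` for crux stmt-Langlands-17006
`Summit.Langlands.Langlands.Theses.NonParallelVoid.VoidToLanglands` (crux-strategist, 2026-08-17;
maintained by the lead prover-line-stmt-Langlands-17006-0 from cycle 1: stub U discharged from the landed
`Theorems/NonParallelVoidVoidToLanglandsStubAvatarConjugacy.lean` (p165550), tightness certificate §4 added)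

THE CRUX (rank 9, the route's declared remainder, D-0027 §2.1): `VoidToLanglands := Target → Langlands`,
`Target` = NON-PARALLEL WEIGHTS ARE VOID (for `F` imaginary quadratic, every irreducible, a.e.-unramified
`ρ : Γ_F → GL₂(ℚ̄_ℓ)` that is de Rham for Fontaine's pinned datum with two distinct `τ`-labelled Hodge–Tate
weights at every label above `ℓ` has ONE common gap).  The registered line `birth` cuts `Langlands` by
direction: N ⊓ (A) ⊓ (B off the sector 𝔖) ⊓ (B on 𝔖, parallel), 𝔖 := `n = 2 ∧ F imaginary quadratic ∧ ρ
regular at every label`, each (A)/(B) stub being the FULL statement — existence AND local–global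
compatibility at EVERY finite place for EVERY Henniart-normalised datum `𝓡`.

THIS LINE cuts along the OTHER axis first — Satake level versus local–global level — using the tree's own
typed partition of `GL_n` reciprocity (route PrimeSwitchSplit rev 3: B_w ⊓ W⁺ ⊓ P ⊓ L∤ ⊓ U, whose `closes` is
proved), re-typed for the served `∀ 𝓡` statement (RD = the `Nonempty` conjunct, L∤∀ = Taylor's Conj. 7 away
from `ℓ` for EVERY datum — exactly the leaves certified by the sibling strategists of
CapacityClassicality.SectorToLanglands (10368) and RamifiedCoefficientSeed.SectorComplement (16781)), and THEN
cuts the Satake-level automorphy leaf B_w along 𝔖 so that `Target` is load-bearing: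

* `stub_weakParallelModularity` — THE STUB FED BY `Target`: every irreducible, a.e.-unramified, pinned-de Rham,
  regular `ρ : Γ_F → GL₂(ℚ̄_ℓ)` over an imaginary quadratic `F` whose labelled weights are PARALLEL is
  Satake–Frobenius compatible a.e. with an L-algebraic cuspidal `π` of `GL₂(𝔸_F)` (weak = Satake-level
  modularity of regular parallel-weight Bianchi Galois representations: the Calegari–Geraghty / ACC+ /
  Caraiani–Newton frontier at defect `ℓ₀ = 1`).  No `LocalGlobalCompatibleAt`, no `𝓡`, no `D_pst` in the
  conclusion: the ε-pinned Weil–Deligne normalisation that makes `birth`'s on-sector stub formally undecidable on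
  ramified `ρ` (clause F8, definition item D2 pending) does not occur here.
* `stub_weakAutomorphyOffSector` — B_w (PrimeSwitchSplit.WeakGeometricAutomorphy, stmt-Langlands-17414) OFF 𝔖.
* `stub_satakeAvatarExistence` — W⁺ = stmt-Langlands-17415 VERBATIM (irreducible Satake avatar of every
  L-algebraic cuspidal `π`; served crux of PrimeSwitchSplit / CompatibleFamilySplit).
* `stub_padicMemberCompatibility` — P = stmt-Langlands-17534 VERBATIM (de Rham member + prime switch).
* `stub_compatibilityAwayFromLAll` — L∤∀, the `∀ Rec` form of stmt-Langlands-17417, VERBATIM the text published by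
  cstrat-16781 (`Cruxes/SectorComplement/Lines/birth_CompatibilityAwayFromLAll.lean`).
* `stub_canonicalReciprocityData` — RD = stmt-Langlands-17930 VERBATIM (WachComponentCensus support).
* `stub_avatarConjugacy` — U = stmt-Langlands-17844 VERBATIM (provable now from the landed
  `ReciprocityUpToIrreducibility.isConjugate_of_satakeFrobCompatibleAt`, p119850, modulo that module's cone).

`VoidToLanglands_of` (kernel-checked, no `sorry`; hypotheses = the seven stub statements BY NAME through
`_Goal.stub_x := type_of% @stub_x`; conclusion = the route decl BY NAME; every hypothesis used): given `Target`,
fix `F`; `Nonempty (ReciprocityData F)` from RD; for EVERY datum `Rec`: the local–global helper of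
PrimeSwitchSplit.closes (irreducible Satake-compatible pairs are `Rec`-geometric — unramified a.e. from the Satake
clause, de Rham by P(i) — and compatible at every finite place: `v ∤ ℓ` by L∤∀, `v ∣ ℓ` read through an
auxiliary prime `ℓ' ∈ {2, 3}` below it: W⁺ at `ℓ'`, L∤∀ at `(ℓ', v)`, P(ii)); weak (B) by `by_cases 𝔖`: ON 𝔖,
`subst n = 2`, `Target` (fed `hgeo.1`, `hgeo.2`, regularity) makes the weights parallel and
`stub_weakParallelModularity` applies, OFF 𝔖 `stub_weakAutomorphyOffSector`; then (A) = W⁺ + helper + U and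
(B) = weak (B) + helper.

Disproof used: none exists for this crux (payload `disproof_path` absent on disk, `ledger crux ls`: no
Disproof.lean, 2026-08-17); `ledger negatives --problem Langlands`: nothing of the shape of these stubs.
References: [BuzzardGeeLMS2014] Conj. 3.2.1–3.2.2; [FontaineMazurGeometric1995] Conj. 1;
[TaylorGaloisRepresentations2004] Conj. 7–8; [HarrisTaylorAMS2001] Thm A; [DeligneSerreASENS1974] Lemme 3.2;
[CalegariGeraghty2017] §5; [ACCGHLNSTT2023] Thm 6.1.1–6.1.2; [CaraianiNewton2023] Thm 1.1; [CalegariMazur2008]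
Conj. 1.3; [AHTW2026] = arXiv:2607.11763 Conj. 1.1.2–1.1.3.
-/

set_option linter.dupNamespace false

noncomputable section

open scoped BigOperators Topology Classical Matrix NumberField
open Filter IsDedekindDomain

namespace Summit.Langlands.Langlands.Cruxes.VoidToLanglands.SatakeSectorCut

open Summit.Langlands
open Summit.Langlands.Langlands.Theses.NonParallelVoid (Target VoidToLanglands)

/-! ## 0. The crux by name -/

/-- The crux IS `Target → Langlands`, definitionally. [folklore] -/
theorem voidToLanglands_iff : VoidToLanglands ↔ (Target → _root_.Langlands) :=
  Iff.rfl

/-! ## 1. The seven stubs (the ONLY sorries of this file) -/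

/-- **stub RD — reciprocity data exist** (the summit's non-vacuity conjunct; VERBATIM item stmt-Langlands-17930
`WachComponentCensus.CanonicalReciprocityData`): at every finite place a local Langlands correspondence for the
`GL_m(F_v)` normalised against THE canonical local Artin map (Harris–Taylor 2001 Thm A / Henniart 2000; in tree a
T0 debt: `LocalLanglandsDatum.nonempty` + the canonical-Artin pins).  Size M given the named facts.
[cite: HarrisTaylorAMS2001, Thm. A] [cite: HenniartInventiones2000, Thm. 1.1] -/
theorem stub_canonicalReciprocityData :
    ∀ (F : Type) [Field F] [NumberField F], Nonempty (Summit.Langlands.ReciprocityData F) := by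
  sorry

/-- **stub W⁺ — irreducible Satake avatar** (VERBATIM item stmt-Langlands-17415
`PrimeSwitchSplit.SatakeAvatarExistence`): every L-algebraic cuspidal `π` of `GL_n(𝔸_K)` has, for every
`(ℓ, ι)`, an IRREDUCIBLE `ρ : Γ_K → GL_n(ℚ̄_ℓ)` Satake–Frobenius compatible with `(π, ι)` a.e. (Buzzard–Gee
Conj. 3.2.2 weak form + Ramakrishnan's cuspidal ⇒ irreducible).  Known for regular algebraic `π` over CM /
totally real `K` (HLTT 2016, Scholze 2015; irreducibility for `n = 2` and in density-one / polarized cases);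
OPEN for irregular `π` and general `K`.  Size open-problem.
[cite: BuzzardGeeLMS2014, Conj. 3.2.2] [cite: HarrisLanTaylorThorneRMS2016, Thm. A] [cite: Scholze2015, Cor. V.4.2] -/
theorem stub_satakeAvatarExistence :
    ∀ (K : Type) [Field K] [NumberField K] (n : ℕ) (hcpt : Literature.NumberTheory.Automorphic.isCompact_glFiniteIntegralLevel n K), 0 < n → ∀ (π : Literature.NumberTheory.Automorphic.CuspidalAutomorphicRepData n K hcpt), π.1.IsLAlgebraic → ∀ (ℓ : ℕ) [Fact ℓ.Prime] (ι : PadicAlgCl ℓ ≃+* ℂ), ∃ ρ : Literature.NumberTheory.GaloisRepresentations.FramedGaloisRep K (PadicAlgCl ℓ) n, ρ.toGaloisRep.IsIrreducible ∧ ∀ᶠ v : IsDedekindDomain.HeightOneSpectrum (NumberField.RingOfIntegers K) in cofinite, SatakeFrobCompatibleAt ι π.1 ρ v := by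
  sorry

/-- **stub P — de Rham member and the prime switch** (VERBATIM item stmt-Langlands-17534
`PrimeSwitchSplit.PadicMemberCompatibility`): for an irreducible `ℓ`-adic Satake avatar `ρ` of `(π, ι)` and
`v ∣ ℓ`: (i) `ρ|_v` is de Rham for Fontaine's pinned datum; (ii) for EVERY datum `Rec`, local–global
compatibility at `v` of an `ℓ'`-adic avatar (`ℓ' ∤ v`) implies that of `ρ` (Fontaine's `C_WD` for the system;
Saito / Caraiani / AHTW 2026 up to semisimplification for regular `π` over CM).  Size open-problem; (ii)'s
ramified sector formally waits for definition item D2.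
[cite: FontaineAsterisque223VIII, §2.3.7] [cite: AHTW2026, Thm. 1.2.1] [cite: Caraiani2014, Thm. 1.1] -/
theorem stub_padicMemberCompatibility :
    ∀ (K : Type) [Field K] [NumberField K] (n : ℕ) (hcpt : Literature.NumberTheory.Automorphic.isCompact_glFiniteIntegralLevel n K), 0 < n → ∀ (π : Literature.NumberTheory.Automorphic.CuspidalAutomorphicRepData n K hcpt), π.1.IsLAlgebraic → ∀ (ℓ : ℕ) [Fact ℓ.Prime] (ι : PadicAlgCl ℓ ≃+* ℂ) (ρ : Literature.NumberTheory.GaloisRepresentations.FramedGaloisRep K (PadicAlgCl ℓ) n), ρ.toGaloisRep.IsIrreducible → (∀ᶠ v : IsDedekindDomain.HeightOneSpectrum (NumberField.RingOfIntegers K) in cofinite, SatakeFrobCompatibleAt ι π.1 ρ v) → ∀ (v : IsDedekindDomain.HeightOneSpectrum (NumberField.RingOfIntegers K)) (hv : ((ℓ : ℕ) : NumberField.RingOfIntegers K) ∈ v.asIdeal), (Literature.NumberTheory.PAdicHodge.fontainePstAdicCompletion v ℓ hv).IsDeRhamFramed (ρ.toLocal v) ∧ ∀ (Rec : ReciprocityData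 K) (ℓ' : ℕ) [Fact ℓ'.Prime] (ι' : PadicAlgCl ℓ' ≃+* ℂ) (ρ' : Literature.NumberTheory.GaloisRepresentations.FramedGaloisRep K (PadicAlgCl ℓ') n), ((ℓ' : ℕ) : NumberField.RingOfIntegers K) ∉ v.asIdeal → ρ'.toGaloisRep.IsIrreducible → (∀ᶠ w : IsDedekindDomain.HeightOneSpectrum (NumberField.RingOfIntegers K) in cofinite, SatakeFrobCompatibleAt ι' π.1 ρ' w) → LocalGlobalCompatibleAt Rec ι' π.1 ρ' v → LocalGlobalCompatibleAt Rec ι π.1 ρ v := by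
  sorry

/-- **stub L∤∀ — Taylor's Conj. 7 away from `ℓ`, for EVERY reciprocity datum** (the `∀ Rec` form of item
stmt-Langlands-17417, VERBATIM the text `CompatibilityAwayFromLAll` published by the strategist of
stmt-Langlands-16781): every irreducible pinned-geometric `ρ` Satake–Frobenius compatible a.e. with an
L-algebraic cuspidal `π` is locally–globally compatible with it at every finite `v ∤ ℓ`, for every
Henniart-normalised `Rec`.  Known for regular conjugate-self-dual `π` over CM (Harris–Taylor, Taylor–Yoshida,
Caraiani) and up to `N` in the regular non-polarisable case (Varma 2024); OPEN in general.  Size open-problem.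
[cite: TaylorGaloisRepresentations2004, Conj. 7] [cite: VarmaFMS2024, Thm. 1] [cite: Caraiani2012, Thm. 1.1] -/
theorem stub_compatibilityAwayFromLAll :
    ∀ (K : Type) [Field K] [NumberField K] (Rec : ReciprocityData K) (n : ℕ) (hcpt : Literature.NumberTheory.Automorphic.isCompact_glFiniteIntegralLevel n K), 0 < n → ∀ (π : Literature.NumberTheory.Automorphic.CuspidalAutomorphicRepData n K hcpt), π.1.IsLAlgebraic → ∀ (ℓ : ℕ) [Fact ℓ.Prime] (ι : PadicAlgCl ℓ ≃+* ℂ) (ρ : Literature.NumberTheory.GaloisRepresentations.FramedGaloisRep K (PadicAlgCl ℓ) n), ρ.toGaloisRep.IsIrreducible → ((∀ᶠ v : IsDedekindDomain.HeightOneSpectrum (NumberField.RingOfIntegers K) in cofinite, ρ.IsUnramifiedAt v) ∧ ∀ (v : IsDedekindDomain.HeightOneSpectrum (NumberField.RingOfIntegers K)) (hv : ((ℓ : ℕ) : NumberField.RingOfIntegers K) ∈ v.asIdeal), (Literature.NumberTheory.PAdicHodge.fontainePstAdicCompletion v ℓ hv).IsDeRhamFramed (ρ.toLocal v)) → (∀ᶠ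 v : IsDedekindDomain.HeightOneSpectrum (NumberField.RingOfIntegers K) in cofinite, SatakeFrobCompatibleAt ι π.1 ρ v) → ∀ v : IsDedekindDomain.HeightOneSpectrum (NumberField.RingOfIntegers K), ((ℓ : ℕ) : NumberField.RingOfIntegers K) ∉ v.asIdeal → LocalGlobalCompatibleAt Rec ι π.1 ρ v := by
  sorry

/-- **stub U — uniqueness of the irreducible Satake avatar up to conjugacy** (VERBATIM item stmt-Langlands-17844
`PrimeSwitchSplit.AvatarConjugacy`; Chebotarev + Brauer–Nesbitt, Deligne–Serre Lemme 3.2).  PROVABLE NOW: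
`fun K _ _ n hcpt π ℓ _ ι ρ₀ ρ h₀ hρ₀ hρ => isConjugate_of_satakeFrobCompatibleAt π.1 ι h₀ hρ₀ hρ` from the landed
`Summit.Langlands.Langlands.Theorems.ReciprocityUpToIrreducibility.isConjugate_of_satakeFrobCompatibleAt`
(p119850).  CLOSED by the lead (cycle 1): landed verbatim as
`Summit.Langlands.Langlands.Theorems.NonParallelVoidSatakeSectorCut.stub_avatarConjugacy` (p165550) and imported here.
[cite: DeligneSerreASENS1974, Lemme 3.2] -/
theorem stub_avatarConjugacy :
    ∀ (K : Type) [Field K] [NumberField K] (n : ℕ) (hcpt : Literature.NumberTheory.Automorphic.isCompact_glFiniteIntegralLevel n K) (π : Literature.NumberTheory.Automorphic.CuspidalAutomorphicRepData n K hcpt) (ℓ : ℕ) [Fact ℓ.Prime] (ι : PadicAlgCl ℓ ≃+* ℂ) (ρ₀ ρ : Literature.NumberTheory.GaloisRepresentations.FramedGaloisRep K (PadicAlgCl ℓ) n), ρ₀.toGaloisRep.IsIrreducible → (∀ᶠ v : IsDedekindDomain.HeightOneSpectrum (NumberField.RingOfIntegers K) in cofinite, SatakeFrobCompatibleAt ι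 π.1 ρ₀ v) → (∀ᶠ v : IsDedekindDomain.HeightOneSpectrum (NumberField.RingOfIntegers K) in cofinite, SatakeFrobCompatibleAt ι π.1 ρ v) → IsConjugate ρ₀ ρ :=
  -- LANDED (p165550): `Theorems/NonParallelVoidVoidToLanglandsStubAvatarConjugacy.lean`
  Summit.Langlands.Langlands.Theorems.NonParallelVoidSatakeSectorCut.stub_avatarConjugacy

/-- **stub B_w⁻ — Satake-level automorphy OFF the route's sector** (PrimeSwitchSplit.WeakGeometricAutomorphy =
stmt-Langlands-17414 restricted to `¬ 𝔖`, 𝔖 := `n = 2 ∧ K imaginary quadratic ∧ ρ regular at every label above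
ℓ` — the sector predicate of line `birth`, verbatim): every irreducible, a.e.-unramified, pinned-de Rham
`ρ : Γ_K → GL_n(ℚ̄_ℓ)` off 𝔖 is Satake–Frobenius compatible a.e. with an L-algebraic cuspidal `π`.  Known
fragments: `n = 1` (class field theory), odd `GL₂/ℚ` (Khare–Wintenberger, Kisin, Emerton, Pan), regular
potentially diagonalisable polarizable `ρ` with adequate `ρ̄` (BLGGT, potential automorphy only), regular `ρ`
over CM under the ACC+ provisos, abelian surfaces / `GSp₄` (BCGP).  OPEN and barrier-bound: even and
Hodge-irregular `ρ` (NonRegularWeightBarrier), residually reducible (ResiduallyReducibleBarrier), `n ≥ 3`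
non-self-dual (TwistedEndoscopySelfDual), mixed-signature `K`.  Why it might fail: it is Fontaine–Mazur–Langlands
(a.e. form) minus one slice.  Size open-problem.
[cite: FontaineMazurGeometric1995, Conj. 1] [cite: KhareWintenberger2009, Thm. 1.2] [cite: BarnetlambEtAl2014, Thm. 4.5.1]
[cite: ACCGHLNSTT2023, Thm. 6.1.1] -/
theorem stub_weakAutomorphyOffSector :
    ∀ (K : Type) [Field K] [NumberField K] (n : ℕ) (hcpt : Literature.NumberTheory.Automorphic.isCompact_glFiniteIntegralLevel n K), 0 < n → ∀ (ℓ : ℕ) [Fact ℓ.Prime] (ι : PadicAlgCl ℓ ≃+* ℂ) (ρ : Literature.NumberTheory.GaloisRepresentations.FramedGaloisRep K (PadicAlgCl ℓ) n), ρ.toGaloisRep.IsIrreducible → ((∀ᶠ v : IsDedekindDomain.HeightOneSpectrum (NumberField.RingOfIntegers K) in cofinite, ρ.IsUnramifiedAt v) ∧ ∀ (v : IsDedekindDomain.HeightOneSpectrum (NumberField.RingOfIntegers K)) (hv : ((ℓ : ℕ) : NumberField.RingOfIntegers K) ∈ v.asIdeal), (Literature.NumberTheory.PAdicHodge.fontainePstAdicCompletion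 v ℓ hv).IsDeRhamFramed (ρ.toLocal v)) → ¬ (n = 2 ∧ Algebra.IsQuadraticExtension ℚ K ∧ NumberField.IsTotallyComplex K ∧ ∀ (v : IsDedekindDomain.HeightOneSpectrum (NumberField.RingOfIntegers K)) (hv : ((ℓ : ℕ) : NumberField.RingOfIntegers K) ∈ v.asIdeal), letI := (Literature.NumberTheory.PAdicHodge.fontainePstAdicCompletion v ℓ hv).algebra; ∀ τ : v.adicCompletion K →ₐ[ℚ_[ℓ]] PadicAlgCl ℓ, ∃ a b : ℤ, a < b ∧ ρ.labelledHodgeTateWeightsAt v (Literature.NumberTheory.PAdicHodge.fontainePstAdicCompletion v ℓ hv).algebra (Literature.NumberTheory.PAdicHodge.fontainePstAdicCompletion v ℓ hv).𝔅 τ.toRingHom = {a, b}) → ∃ π : Literature.NumberTheory.Automorphic.CuspidalAutomorphicRepData n K hcpt, π.1.IsLAlgebraic ∧ ∀ᶠ v : IsDedekindDomain.HeightOneSpectrum (NumberField.RingOfIntegers K) in cofinite, SatakeFrobCompatibleAt ι π.1 ρ v := by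
  sorry

/-- **stub B_w⁺ — WEAK PARALLEL MODULARITY over imaginary quadratic fields: THE STUB FED BY `Target`.**
For `F` imaginary quadratic, every irreducible, a.e.-unramified `ρ : Γ_F → GL₂(ℚ̄_ℓ)`, de Rham for Fontaine's
pinned datum, with two distinct `τ`-labelled Hodge–Tate weights at every label above `ℓ` AND one common gap `g`
(`HT_τ = {a_τ, a_τ + g}` — PARALLEL regular weight; after an algebraic twist, the weight of a cohomological
Bianchi eigenclass) is Satake–Frobenius compatible a.e. with an L-algebraic cuspidal `π` of `GL₂(𝔸_F)`.
TECHNIQUE WITH TEETH: Calegari–Geraghty patching at defect `ℓ₀ = 1` with the torsion local–global compatibility of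
ACC+ §§3–5 / Caraiani–Newton: the modularity LIFTING half is a theorem in the Fontaine–Laffaille crystalline and
in the ordinary ranges (ACC+ Thm 6.1.1 / 6.1.2; Caraiani–Newton Thm 1.2 removes "ℓ split in F" for `n = 2`),
and RESIDUAL modularity is known for `ρ̄` with image containing `SL₂(𝔽_3)`/`SL₂(𝔽_5)`-type via the 2-3 / 3-5
switch (Caraiani–Newton §6–7, elliptic curves).  OPEN: residually reducible (Skinner–Wiles at defect one),
residually dihedral-degenerate, `ℓ` small or ramified in `F`, weights outside Fontaine–Laffaille and
non-ordinary (no change of weight at defect one), and residual modularity in general (Serre's conjecture over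
imaginary quadratic fields).  Why it might fail: none short of `¬ Langlands` (the summit implies it: it is a
restriction of B_w); as a PROOF target the residually reducible supersingular corner has no engine.
Size open-problem (with a living engine).
[cite: CalegariGeraghty2017, §5] [cite: ACCGHLNSTT2023, Thm. 6.1.1] [cite: CaraianiNewton2023, Thm. 1.1]
[cite: CalegariMazur2008, Conj. 1.3] [cite: FontaineMazurGeometric1995, Conj. 1] -/
theorem stub_weakParallelModularity :
    ∀ (F : Type) [Field F] [NumberField F] [Algebra.IsQuadraticExtension ℚ F], NumberField.IsTotallyComplex F → ∀ (hcpt : Literature.NumberTheory.Automorphic.isCompact_glFiniteIntegralLevel 2 F) (ℓ : ℕ) [Fact ℓ.Prime] (ι : PadicAlgCl ℓ ≃+* ℂ) (ρ : Literature.NumberTheory.GaloisRepresentations.FramedGaloisRep F (PadicAlgCl ℓ) 2), ρ.toGaloisRep.IsIrreducible → ((∀ᶠ v : IsDedekindDomain.HeightOneSpectrum (NumberField.RingOfIntegers F) in cofinite, ρ.IsUnramifiedAt v) ∧ ∀ (v : IsDedekindDomain.HeightOneSpectrum (NumberField.RingOfIntegers F)) (hv : ((ℓ : ℕ) : NumberField.RingOfIntegers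 F) ∈ v.asIdeal), (Literature.NumberTheory.PAdicHodge.fontainePstAdicCompletion v ℓ hv).IsDeRhamFramed (ρ.toLocal v)) → (∀ (v : IsDedekindDomain.HeightOneSpectrum (NumberField.RingOfIntegers F)) (hv : ((ℓ : ℕ) : NumberField.RingOfIntegers F) ∈ v.asIdeal), letI := (Literature.NumberTheory.PAdicHodge.fontainePstAdicCompletion v ℓ hv).algebra; ∀ τ : v.adicCompletion F →ₐ[ℚ_[ℓ]] PadicAlgCl ℓ, ∃ a b : ℤ, a < b ∧ ρ.labelledHodgeTateWeightsAt v (Literature.NumberTheory.PAdicHodge.fontainePstAdicCompletion v ℓ hv).algebra (Literature.NumberTheory.PAdicHodge.fontainePstAdicCompletion v ℓ hv).𝔅 τ.toRingHom = {a, b}) → (∃ g : ℤ, ∀ (v : IsDedekindDomain.HeightOneSpectrum (NumberField.RingOfIntegers F)) (hv : ((ℓ : ℕ) : NumberField.RingOfIntegers F) ∈ v.asIdeal), letI := (Literature.NumberTheory.PAdicHodge.fontainePstAdicCompletion v ℓ hv).algebra; ∀ τ : v.adicCompletion F →ₐ[ℚ_[ℓ]] PadicAlgCl ℓ, ∃ a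 : ℤ, ρ.labelledHodgeTateWeightsAt v (Literature.NumberTheory.PAdicHodge.fontainePstAdicCompletion v ℓ hv).algebra (Literature.NumberTheory.PAdicHodge.fontainePstAdicCompletion v ℓ hv).𝔅 τ.toRingHom = {a, a + g}) → ∃ π : Literature.NumberTheory.Automorphic.CuspidalAutomorphicRepData 2 F hcpt, π.1.IsLAlgebraic ∧ ∀ᶠ v : IsDedekindDomain.HeightOneSpectrum (NumberField.RingOfIntegers F) in cofinite, SatakeFrobCompatibleAt ι π.1 ρ v := by
  sorry

/-! ## 2. The stub statements as named propositions (the composition's hypotheses, by name)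

Each `_Goal.stub_x` is `type_of% @stub_x`: literally the stub's statement, no text duplicated, no `sorry`
inherited. -/

namespace _Goal

/-- The statement of `stub_canonicalReciprocityData` (literally its type). [folklore] -/
def stub_canonicalReciprocityData : Prop :=
  type_of% @Summit.Langlands.Langlands.Cruxes.VoidToLanglands.SatakeSectorCut.stub_canonicalReciprocityData

/-- The statement of `stub_satakeAvatarExistence` (literally its type). [folklore] -/
def stub_satakeAvatarExistence : Prop :=
  type_of% @Summit.Langlands.Langlands.Cruxes.VoidToLanglands.SatakeSectorCut.stub_satakeAvatarExistence

/-- The statement of `stub_padicMemberCompatibility` (literally its type). [folklore] -/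
def stub_padicMemberCompatibility : Prop :=
  type_of% @Summit.Langlands.Langlands.Cruxes.VoidToLanglands.SatakeSectorCut.stub_padicMemberCompatibility

/-- The statement of `stub_compatibilityAwayFromLAll` (literally its type). [folklore] -/
def stub_compatibilityAwayFromLAll : Prop :=
  type_of% @Summit.Langlands.Langlands.Cruxes.VoidToLanglands.SatakeSectorCut.stub_compatibilityAwayFromLAll

/-- The statement of `stub_avatarConjugacy` (literally its type). [folklore] -/
def stub_avatarConjugacy : Prop :=
  type_of% @Summit.Langlands.Langlands.Cruxes.VoidToLanglands.SatakeSectorCut.stub_avatarConjugacy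

/-- The statement of `stub_weakAutomorphyOffSector` (literally its type). [folklore] -/
def stub_weakAutomorphyOffSector : Prop :=
  type_of% @Summit.Langlands.Langlands.Cruxes.VoidToLanglands.SatakeSectorCut.stub_weakAutomorphyOffSector

/-- The statement of `stub_weakParallelModularity` (literally its type). [folklore] -/
def stub_weakParallelModularity : Prop :=
  type_of% @Summit.Langlands.Langlands.Cruxes.VoidToLanglands.SatakeSectorCut.stub_weakParallelModularity

end _Goal

/-! ## 3. The composition (kernel-checked, no `sorry`): RD → W⁺ → P → L∤∀ → B_w⁻ → B_w⁺ → VoidToLanglands (U landed, used by name) -/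

/-- **`VoidToLanglands` from its seven stubs** (Satake level ⊓ local–global level ⊓ sector cut).  Given
`Target`, fix `F`; non-vacuity from RD; for every datum `Rec`: the local–global helper (P(i), L∤∀, and above `ℓ`
the prime switch P(ii) through an `ℓ'`-adic avatar from W⁺, `ℓ' ∈ {2,3}`), weak (B) by the sector split — ON 𝔖
`Target` makes the weights parallel and `stub_weakParallelModularity` applies, OFF 𝔖
`stub_weakAutomorphyOffSector` —, then (A) = W⁺ + helper + U and (B) = weak (B) + helper.  Hypotheses = the
six OPEN stub statements by name (U is landed and used by name); conclusion = the route decl by name; every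
hypothesis is used.
[cite: BuzzardGeeLMS2014, Conj. 3.2.1 and Conj. 3.2.2] [cite: CalegariMazur2008, Conj. 1.3]
[cite: DeligneSerreASENS1974, Lemme 3.2] -/
theorem VoidToLanglands_of (hRD : _Goal.stub_canonicalReciprocityData)
    (hW : _Goal.stub_satakeAvatarExistence) (hP : _Goal.stub_padicMemberCompatibility)
    (hA : _Goal.stub_compatibilityAwayFromLAll)
    (hOff : _Goal.stub_weakAutomorphyOffSector) (hPar : _Goal.stub_weakParallelModularity) :
    Summit.Langlands.Langlands.Theses.NonParallelVoid.VoidToLanglands := by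
  -- U (`stub_avatarConjugacy`) is LANDED (p165550) and used by name below, no longer a hypothesis
  have hU : _Goal.stub_avatarConjugacy := stub_avatarConjugacy
  unfold _Goal.stub_canonicalReciprocityData at hRD
  unfold _Goal.stub_satakeAvatarExistence at hW
  unfold _Goal.stub_padicMemberCompatibility at hP
  unfold _Goal.stub_compatibilityAwayFromLAll at hA
  unfold _Goal.stub_avatarConjugacy at hU
  unfold _Goal.stub_weakAutomorphyOffSector at hOff
  unfold _Goal.stub_weakParallelModularity at hPar
  intro hT F _ _
  refine ⟨hRD F, fun Rec n hn hcpt => ?_⟩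
  -- every finite place misses the prime 2 or the prime 3
  have hprime : ∀ v : IsDedekindDomain.HeightOneSpectrum (NumberField.RingOfIntegers F),
      ∃ (ℓ' : ℕ) (_ : Fact ℓ'.Prime), ((ℓ' : ℕ) : NumberField.RingOfIntegers F) ∉ v.asIdeal := by
    intro v
    by_cases h2 : ((2 : ℕ) : NumberField.RingOfIntegers F) ∈ v.asIdeal
    · refine ⟨3, ⟨Nat.prime_three⟩, fun h3 => v.isPrime.ne_top ((Ideal.eq_top_iff_one _).2 ?_)⟩
      have h := v.asIdeal.sub_mem h3 h2
      have h1 : ((3 : ℕ) : NumberField.RingOfIntegers F) - ((2 : ℕ) : NumberField.RingOfIntegers F) = 1 := by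
        push_cast; norm_num
      rwa [h1] at h
    · exact ⟨2, ⟨Nat.prime_two⟩, h2⟩
  -- the local–global helper for the datum `Rec`: geometric + compatible at EVERY finite place, for
  -- irreducible Satake–Frobenius compatible pairs; above ℓ the place is read through a prime below it
  have hLGC : ∀ (π : Literature.NumberTheory.Automorphic.CuspidalAutomorphicRepData n F hcpt), π.1.IsLAlgebraic →
      ∀ (ℓ : ℕ) [Fact ℓ.Prime] (ι : PadicAlgCl ℓ ≃+* ℂ)
        (ρ : Literature.NumberTheory.GaloisRepresentations.FramedGaloisRep F (PadicAlgCl ℓ) n),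
        ρ.toGaloisRep.IsIrreducible →
        (∀ᶠ v : IsDedekindDomain.HeightOneSpectrum (NumberField.RingOfIntegers F) in cofinite,
          SatakeFrobCompatibleAt ι π.1 ρ v) →
        IsGeometricFramed Rec ρ ∧
          ∀ v : IsDedekindDomain.HeightOneSpectrum (NumberField.RingOfIntegers F),
            LocalGlobalCompatibleAt Rec ι π.1 ρ v := by
    intro π hL ℓ _ ι ρ hirr hρ
    have hgeo : (∀ᶠ v : IsDedekindDomain.HeightOneSpectrum (NumberField.RingOfIntegers F) in cofinite,
        ρ.IsUnramifiedAt v) ∧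
        ∀ (v : IsDedekindDomain.HeightOneSpectrum (NumberField.RingOfIntegers F))
          (hv : ((ℓ : ℕ) : NumberField.RingOfIntegers F) ∈ v.asIdeal),
          (Literature.NumberTheory.PAdicHodge.fontainePstAdicCompletion v ℓ hv).IsDeRhamFramed
            (ρ.toLocal v) :=
      ⟨hρ.mono fun v ⟨_, _, hur, _⟩ => hur, fun v hv => (hP F n hcpt hn π hL ℓ ι ρ hirr hρ v hv).1⟩
    refine ⟨hgeo, fun v => ?_⟩
    by_cases hv : ((ℓ : ℕ) : NumberField.RingOfIntegers F) ∈ v.asIdeal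
    · obtain ⟨ℓ', _, hℓ'⟩ := hprime v
      obtain ⟨ι'⟩ := PadicAlgCl.nonempty_ringEquiv_complex ℓ'
      obtain ⟨ρ', hirr', hρ'⟩ := hW F n hcpt hn π hL ℓ' ι'
      have hgeo' : (∀ᶠ w : IsDedekindDomain.HeightOneSpectrum (NumberField.RingOfIntegers F) in cofinite,
          ρ'.IsUnramifiedAt w) ∧
          ∀ (w : IsDedekindDomain.HeightOneSpectrum (NumberField.RingOfIntegers F))
            (hw : ((ℓ' : ℕ) : NumberField.RingOfIntegers F) ∈ w.asIdeal),
            (Literature.NumberTheory.PAdicHodge.fontainePstAdicCompletion w ℓ' hw).IsDeRhamFramed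
              (ρ'.toLocal w) :=
        ⟨hρ'.mono fun w ⟨_, _, hur, _⟩ => hur,
          fun w hw => (hP F n hcpt hn π hL ℓ' ι' ρ' hirr' hρ' w hw).1⟩
      -- the prime switch: compatibility with the ℓ'-adic avatar at v, moved to the ℓ-adic one by P(ii)
      exact (hP F n hcpt hn π hL ℓ ι ρ hirr hρ v hv).2 Rec ℓ' ι' ρ' hℓ' hirr' hρ'
        (hA F Rec n hcpt hn π hL ℓ' ι' ρ' hirr' hgeo' hρ' v hℓ')
    · exact hA F Rec n hcpt hn π hL ℓ ι ρ hirr hgeo hρ v hv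
  -- weak (B) for this (F, n): Satake-level automorphy of every irreducible geometric ρ, by the SECTOR CUT;
  -- on the sector the non-parallel weights are emptied by `Target`
  have hBw : ∀ (ℓ : ℕ) [Fact ℓ.Prime] (ι : PadicAlgCl ℓ ≃+* ℂ)
      (ρ : Literature.NumberTheory.GaloisRepresentations.FramedGaloisRep F (PadicAlgCl ℓ) n),
      ρ.toGaloisRep.IsIrreducible → IsGeometricFramed Rec ρ →
      ∃ π : Literature.NumberTheory.Automorphic.CuspidalAutomorphicRepData n F hcpt, π.1.IsLAlgebraic ∧
        ∀ᶠ v : IsDedekindDomain.HeightOneSpectrum (NumberField.RingOfIntegers F) in cofinite,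
          SatakeFrobCompatibleAt ι π.1 ρ v := by
    intro ℓ _ ι ρ hirr hgeo
    by_cases hs : (n = 2 ∧ Algebra.IsQuadraticExtension ℚ F ∧ NumberField.IsTotallyComplex F ∧ ∀ (v : IsDedekindDomain.HeightOneSpectrum (NumberField.RingOfIntegers F)) (hv : ((ℓ : ℕ) : NumberField.RingOfIntegers F) ∈ v.asIdeal), letI := (Literature.NumberTheory.PAdicHodge.fontainePstAdicCompletion v ℓ hv).algebra; ∀ τ : v.adicCompletion F →ₐ[ℚ_[ℓ]] PadicAlgCl ℓ, ∃ a b : ℤ, a < b ∧ ρ.labelledHodgeTateWeightsAt v (Literature.NumberTheory.PAdicHodge.fontainePstAdicCompletion v ℓ hv).algebra (Literature.NumberTheory.PAdicHodge.fontainePstAdicCompletion v ℓ hv).𝔅 τ.toRingHom = {a, b})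
    · obtain ⟨rfl, hq, hc, hreg⟩ := hs
      haveI := hq
      -- `Target`: on the sector every regular `ρ` has parallel gaps
      have hpar := hT F hc ℓ ρ hirr hgeo.1 (fun v hv => ⟨hgeo.2 v hv, hreg v hv⟩)
      exact hPar F hc hcpt ℓ ι ρ hirr hgeo hreg hpar
    · exact hOff F n hcpt hn ℓ ι ρ hirr hgeo hs
  refine ⟨?_, ?_⟩
  · -- (A) automorphic → Galois, with uniqueness up to conjugacy from U
    intro π hL ℓ _ ι
    obtain ⟨ρ, hirr, hρ⟩ := hW F n hcpt hn π hL ℓ ι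
    obtain ⟨hgeo, hloc⟩ := hLGC π hL ℓ ι ρ hirr hρ
    exact ⟨ρ, hirr, hgeo, ⟨hρ, hloc⟩, fun ρ' h' => hU F n hcpt π ℓ ι ρ ρ' hirr hρ h'.1⟩
  · -- (B) Galois → automorphic
    intro ℓ _ ι ρ hirr hgeo
    obtain ⟨π, hL, hρ⟩ := hBw ℓ ι ρ hirr hgeo
    exact ⟨π, hL, hρ, (hLGC π hL ℓ ι ρ hirr hρ).2⟩

/-- By-name sanity check (an `example`, not a declaration): the seven stubs feed the composition as they
stand. -/
example : Summit.Langlands.Langlands.Theses.NonParallelVoid.VoidToLanglands :=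
  VoidToLanglands_of stub_canonicalReciprocityData stub_satakeAvatarExistence stub_padicMemberCompatibility
    stub_compatibilityAwayFromLAll stub_weakAutomorphyOffSector stub_weakParallelModularity


/-! ## 4. Tightness of the cut (lead, cycle 1): the summit gives back every leaf, so the crux is EXACTLY
`Target → (the seven leaves)`

Landed twin (texts only): `Theorems.NonParallelVoidSatakeSectorCut.nonParallelVoid_voidToLanglands_of_leaves`
(p165550).  The converse below uses directions (A)/(B) of the summit for a pinned datum obtained from the
non-vacuity conjunct, the weak-to-strong upgrade
`ReciprocityUpToIrreducibility.corresponds_of_exists_corresponds` for P and L∤∀, and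
`isGeometricFramed_of_isConjugate` for the de Rham member (`ReciprocityData.pst` IS Fontaine's
`fontainePstAdicCompletion` by definition).  Consequence for refuters: a `stub-false` on ANY leaf is
`¬ Langlands` as typed. -/

/-- **`Langlands` implies the seven leaves** (RD, W⁺, P, L∤∀, U, B_w⁻, B_w⁺ by name).
[cite: BuzzardGeeLMS2014, Conj. 3.2.1 and Conj. 3.2.2] [cite: DeligneSerreASENS1974, Lemme 3.2] -/
theorem leaves_of_langlands (hL : _root_.Langlands) :
    _Goal.stub_canonicalReciprocityData ∧ _Goal.stub_satakeAvatarExistence ∧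
      _Goal.stub_padicMemberCompatibility ∧ _Goal.stub_compatibilityAwayFromLAll ∧
      _Goal.stub_avatarConjugacy ∧ _Goal.stub_weakAutomorphyOffSector ∧ _Goal.stub_weakParallelModularity := by
  unfold _Goal.stub_canonicalReciprocityData _Goal.stub_satakeAvatarExistence
    _Goal.stub_padicMemberCompatibility _Goal.stub_compatibilityAwayFromLAll _Goal.stub_avatarConjugacy
    _Goal.stub_weakAutomorphyOffSector _Goal.stub_weakParallelModularity
  refine ⟨fun F _ _ => (hL F).1, ?_, ?_, ?_, stub_avatarConjugacy, ?_, ?_⟩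
  · -- W⁺: the Satake clause of (A)
    intro K _ _ n hcpt hn π hLalg ℓ _ ι
    obtain ⟨Rec⟩ := (hL K).1
    obtain ⟨ρ, hirr, -, hcorr, -⟩ := ((hL K).2 Rec n hn hcpt).1 π hLalg ℓ ι
    exact ⟨ρ, hirr, hcorr.1⟩
  · -- P: de Rham member and the prime switch, from (A) + weak-to-strong
    intro K _ _ n hcpt hn π hLalg ℓ _ ι ρ hirr hρ v hv
    obtain ⟨Rec₀⟩ := (hL K).1
    refine ⟨?_, fun Rec ℓ' _ ι' ρ' _ _ _ _ => ?_⟩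
    · obtain ⟨ρ₀, hirr₀, hgeo₀, hcorr₀, -⟩ := ((hL K).2 Rec₀ n hn hcpt).1 π hLalg ℓ ι
      have hgeo : IsGeometricFramed Rec₀ ρ :=
        Theorems.ReciprocityUpToIrreducibility.isGeometricFramed_of_isConjugate hgeo₀
          (Theorems.ReciprocityUpToIrreducibility.isConjugate_of_satakeFrobCompatibleAt π.1 ι hirr₀
            hcorr₀.1 hρ)
      exact hgeo.2 v hv
    · obtain ⟨ρ₀, -, -, hcorr₀, -⟩ := ((hL K).2 Rec n hn hcpt).1 π hLalg ℓ ι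
      exact (Theorems.ReciprocityUpToIrreducibility.corresponds_of_exists_corresponds hirr hρ
        ⟨ρ₀, hcorr₀⟩).2 v
  · -- L∤∀: from (A) for the given datum + weak-to-strong
    intro K _ _ Rec n hcpt hn π hLalg ℓ _ ι ρ hirr _ hρ v _
    obtain ⟨ρ₀, -, -, hcorr₀, -⟩ := ((hL K).2 Rec n hn hcpt).1 π hLalg ℓ ι
    exact (Theorems.ReciprocityUpToIrreducibility.corresponds_of_exists_corresponds hirr hρ
      ⟨ρ₀, hcorr₀⟩).2 v
  · -- B_w⁻: the Satake clause of (B), off the sector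
    intro K _ _ n hcpt hn ℓ _ ι ρ hirr hgeo _
    obtain ⟨Rec⟩ := (hL K).1
    obtain ⟨π, hLalg, hcorr⟩ := ((hL K).2 Rec n hn hcpt).2 ℓ ι ρ hirr ⟨hgeo.1, hgeo.2⟩
    exact ⟨π, hLalg, hcorr.1⟩
  · -- B_w⁺: the Satake clause of (B), on the sector (the parallel-weight hypotheses are idle here)
    intro F _ _ _ _ hcpt ℓ _ ι ρ hirr hgeo _ _
    obtain ⟨Rec⟩ := (hL F).1
    obtain ⟨π, hLalg, hcorr⟩ := ((hL F).2 Rec 2 two_pos hcpt).2 ℓ ι ρ hirr ⟨hgeo.1, hgeo.2⟩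
    exact ⟨π, hLalg, hcorr.1⟩

/-- **The crux, exactly**: `VoidToLanglands ↔ (Target → the seven leaves)`. [folklore] -/
theorem voidToLanglands_iff_leaves_of_target :
    Summit.Langlands.Langlands.Theses.NonParallelVoid.VoidToLanglands ↔
      (Target → _Goal.stub_canonicalReciprocityData ∧ _Goal.stub_satakeAvatarExistence ∧
        _Goal.stub_padicMemberCompatibility ∧ _Goal.stub_compatibilityAwayFromLAll ∧
        _Goal.stub_avatarConjugacy ∧ _Goal.stub_weakAutomorphyOffSector ∧ _Goal.stub_weakParallelModularity) := by
  refine ⟨fun h hT => leaves_of_langlands (h hT), fun h hT => ?_⟩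
  obtain ⟨hRD, hW, hP, hA, -, hOff, hPar⟩ := h hT
  exact VoidToLanglands_of hRD hW hP hA hOff hPar hT

end Summit.Langlands.Langlands.Cruxes.VoidToLanglands.SatakeSectorCut

end
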